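import Literature.Geometry.Riemannian.CartanHadamardConjugate
import Mathlib.MeasureTheory.Integral.IntervalIntegral.FundThmCalculus
import HarnessLib

/-!
# Energy estimates for Jacobi fields under a curvature bound: no conjugate or focal zero on short geodesics
(weak forms of Lee 2018, Thm. 11.12 and of Warner's focal comparison, as used in Weinstein 1968, step 4)

Topic `Geometry/Riemannian`; fourth support file of the programme towards the named fact
`Weinstein1968_exists_metric_two_le_multiplicity_of_mem_cutLocus` (`WeinsteinCutLocus.lean`). The
last step of Weinstein's printed proof (zbMATH 0159.23902) is: the cut vectors of the constructed
metric are SHORT beyond the geodesic unit ball `D` of `p`, while **Warner's comparison theorem for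
focal points** (F. W. Warner, Amer. J. Math. 87 (1965)) forbids focal points of `∂D` — hence
conjugate points of `p` — on such short normal geodesics, because the curvature is bounded and
`∂D` is infinitesimally convex. `ConjugateRadiusBound.lean` proved the point version (Jacobi fields
with `J(0) = 0`, along the variations of `exp_p`). This file isolates the underlying **energy
estimate for an abstract Jacobi field along a geodesic** and adds the focal version:

* `eq_zero_of_jacobi_of_integral_lt` — **core estimate, curvature bounded along the geodesic by a
  function of time.** Let `γ` be a geodesic of a covariant derivative `cov` compatible with the
  Riemannian metric `g`, `J` a field along `γ` with differentiable lifts of `J` and `D_t J`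
  satisfying the Jacobi equation `D_t D_t J + R(J, γ') γ' = 0`, and suppose
  `Rm(X, Y, Y, X) ≤ K(t) (g(X,X) g(Y,Y) - g(X,Y)²)` on `T_{γ(t)}M` with `K ≥ 0` continuous (sectional
  curvature `≤ K(t)` along `γ`). If `g(D_tJ(0), J(0)) ≥ 0`, `J(t₁) = 0` for some `t₁ > 0` and
  `g(γ'(0),γ'(0)) · t₁ · ∫₀^{t₁} K < 1`, then `J = 0` on `[0, t₁]` — the form needed when the geodesic
  crosses a thin shell of large curvature (only `∫ K dt` enters);
* `eq_zero_of_jacobi_of_val_nonneg_of_eq_zero` — the same with a constant bound `sec ≤ Λ`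
  (`K = max Λ 0`): condition `max Λ 0 · g(γ'(0), γ'(0)) · t₁² < 1`;
* `eq_zero_of_jacobi_of_eq_zero_of_eq_zero` — **conjugate version** (`J(0) = 0 = J(t₁)` ⇒ `J = 0`
  on `[0, t₁]`): no pair of conjugate zeros at distance `< 1/√(Λ c)`, `c = |γ'|²`
  (Lee 2018, Thm. 11.12 (b), weak form);
* `ne_zero_of_jacobi_of_val_nonneg` — **focal version**: if `g(D_tJ(0), J(0)) ≥ 0` (the initial data
  of a Jacobi field normal to an infinitesimally convex hypersurface, shape operator `≥ 0` towards
  `γ'`) and `J(0) ≠ 0`, then `J(t) ≠ 0` for `0 < t` with `max Λ 0 · c · t² < 1` — no focal point of a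
  convex hypersurface within normal distance `1/√(Λ)` (unit speed), the weak form of Warner 1965,
  Thm. 4.1 / Cor. 4.2 with constant `1` in place of `π/2`.
* `eq_zero_of_jacobi_of_neg_le_of_integral_lt` — **general form of the core estimate** (added
  2026-08-15, the form Weinstein's step 4 actually consumes): the initial data need only be
  `λ`-convex, `g(D_tJ(0), J(0)) ≥ -λ g(J(0), J(0))` with `λ ≥ 0` (shape operator of the exit
  hypersurface `≥ -λ`, as for the boundary of a thin tube about a curve of geodesic curvature `≤ λ`),
  and the curvature bound `sec ≤ K(t)` is required only for `t ∈ [0, t₁]` (along the segment, where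
  the geodesic runs in the unmodified metric); conclusion `J = 0` on `[0, t₁]` as soon as
  `λ t₁ + |γ'|² t₁ ∫₀^{t₁} K < 1`. The original core estimate is now its corollary `λ = 0`;
* `eq_zero_of_jacobi_of_neg_le_of_eq_zero`, `ne_zero_of_jacobi_of_neg_le` — the same with a
  constant bound `sec ≤ Λ` along the segment: no zero on `(0, t₁]` of a Jacobi field with
  `λ`-convex nonzero initial data when `λ t₁ + max Λ 0 · |γ'|² · t₁² < 1` (Warner-type focal
  estimate with a lower bound `-λ` on the shape operator, weak constants).

## The argument (`f = |J|²`, `a = g(D_tJ, J)`, `h = |D_tJ|²`, `c = |γ'|²`)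

`f' = 2a`, `a' = h - Rm(J, γ', γ', J) ≥ h - c K f` (Jacobi equation, curvature bound,
Cauchy–Schwarz). (A) `a - ∫₀ᵗ h + c ∫₀ᵗ K f` is nondecreasing, so
`∫₀^{t₁} h ≤ c ∫₀^{t₁} K f - a(0) ≤ c ∫₀^{t₁} K f` when `J(t₁) = 0` (`a(t₁) = 0`) and `a(0) ≥ 0`.
(With `a(0) ≥ -λ f(0)` instead: `∫₀^{t₁} h ≤ c ∫₀^{t₁} K f + λ f(0)`, and `f(0) ≤ t₁ ∫₀^{t₁} h` by (B).)
(B) Backward Poincaré inequality from the zero at `t₁`: `t ↦ (∫ₜ^{t₁} h) - f(t)/(t₁ - t)` is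
nonincreasing on `(-∞, t₁)` (derivative `-|(t₁-t) D_tJ + J|²/(t₁-t)²`) and tends to `0` at `t₁⁻`
(`f(t₁) = f'(t₁) = 0`), so `f(t) ≤ (t₁ - t) ∫ₜ^{t₁} h ≤ t₁ ∫₀^{t₁} h` on `[0, t₁]`. (C) Hence
`∫₀^{t₁} K f ≤ t₁ (∫₀^{t₁} h) ∫₀^{t₁} K` (`K ≥ 0`). (D) `∫₀^{t₁} h ≤ c t₁ (∫₀^{t₁} K) ∫₀^{t₁} h` with
`c t₁ ∫₀^{t₁} K < 1` forces `∫₀^{t₁} h ≤ 0`, so `f = 0` on `[0, t₁]` by (B).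

No definitions, no named facts (D-0026); theorem-only file, importing only the Jacobi-field layer
(`CartanHadamardConjugate.lean`) — `ConjugateRadiusBound.lean` (the `exp_p` version with `J(0) = 0`)
is logically a special case but was landed first.

## References

* F. W. Warner, *The conjugate locus of a Riemannian manifold* / *Extension of the Rauch
  comparison theorem to submanifolds*, Amer. J. Math. 87 (1965) / Trans. AMS 122 (1966) — cited
  through Weinstein 1968 and zbMATH 0159.23902 ("a theorem of Warner about focal points"); not
  held, statement used only as orientation (weak forms proved here from scratch).
* J. M. Lee, *Introduction to Riemannian Manifolds*, 2nd ed. (2018), Thm. 10.1, Thm. 11.12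
  [LeeRiemannianManifolds2018].
* A. Weinstein, Ann. of Math. 87 (1968) 29–41 [Weinstein1968]; zbMATH Zbl 0159.23902.
-/

noncomputable section

open Bundle Set Filter Function MeasureTheory intervalIntegral
open scoped Manifold ContDiff Topology

namespace Literature.Geometry.Riemannian

open Literature.Geometry.Lorentzian
open Literature.Geometry.Lorentzian.PseudoRiemannianMetric

variable {E : Type*} [NormedAddCommGroup E] [NormedSpace ℝ E] {H : Type*} [TopologicalSpace H]
  {I : ModelWithCorners ℝ E H} {M : Type*} [TopologicalSpace M] [ChartedSpace H M]
  [IsManifold I ∞ M] {n : ℕ∞ω} [Fact (1 ≤ n)] [FiniteDimensional ℝ E]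
  {g : PseudoRiemannianMetric I n E (TangentSpace I : M → Type _)}
  {cov : CovariantDerivative I E (TangentSpace I : M → Type _)}

omit [Fact (1 ≤ n)] [FiniteDimensional ℝ E] in
/-- Cauchy–Schwarz for a positive semidefinite scalar product, `g(u, w)² ≤ g(u, u) g(w, w)` (local
copy of `sq_val_le_mul_val` of `ConjugateRadiusBound.lean`, kept private so that this file stays
low in the import graph). [folklore] -/
private theorem sq_val_le_mul_val' (hnn : ∀ (x : M) (u : TangentSpace I x), 0 ≤ g.val x u u) (x : M)
    (u w : TangentSpace I x) : g.val x u w ^ 2 ≤ g.val x u u * g.val x w w := by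
  set a := g.val x u u with ha
  set b := g.val x u w with hb
  set c := g.val x w w with hc
  have hsymm : g.val x w u = b := (g.symm x w u).trans rfl
  -- the quadratic `r ↦ g(u - r w, u - r w) = a - 2 r b + r² c` is nonnegative
  have hq : ∀ r : ℝ, 0 ≤ a - 2 * r * b + r ^ 2 * c := fun r ↦ by
    have h0 := hnn x (u - r • w)
    have h1 : g.val x (u - r • w) (u - r • w) = a - 2 * r * b + r ^ 2 * c := by
      simp only [map_sub, map_smul, FunLike.coe_sub, FunLike.coe_smul,
        Pi.sub_apply, Pi.smul_apply, smul_eq_mul, hsymm]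
      ring
    rw [h1] at h0
    exact h0
  have hc0 : 0 ≤ c := hnn x w
  rcases hc0.eq_or_lt with hc0 | hcpos
  · -- `c = 0`: then `b = 0`
    have hb0 : b = 0 := by
      by_contra hb0
      have h1 := hq ((a + 1) / (2 * b))
      rw [← hc0] at h1
      have h2 : a - 2 * ((a + 1) / (2 * b)) * b + ((a + 1) / (2 * b)) ^ 2 * 0 = -1 := by
        field_simp
        ring
      rw [h2] at h1
      linarith
    rw [hb0, ← hc0]
    simp
  · have h1 := hq (b / c)
    have h2 : a - 2 * (b / c) * b + (b / c) ^ 2 * c = a - b ^ 2 / c := by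
      field_simp
      ring
    rw [h2] at h1
    have h3 : b ^ 2 / c ≤ a := by linarith
    rwa [div_le_iff₀ hcpos] at h3

/-- **Core energy estimate, general form: a Jacobi field whose initial data are `λ`-convex
(`g(D_tJ(0), J(0)) ≥ -λ |J(0)|²`) and which vanishes at `t₁` is identically zero on `[0, t₁]` when
`t₁` is short relative to `λ` and to the curvature integrated ALONG THE SEGMENT.** Let `cov` be a
covariant derivative compatible with the Riemannian `C^n` metric `g` (`n ≥ 1`), `γ` a geodesic of
`cov` on `ℝ`, `J` a field along `γ` such that the lifts of `J` and `D_t J` to `TM` are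
differentiable and `D_t D_t J + R(J, γ') γ' = 0` (Jacobi equation), and let `K : ℝ → ℝ` be
continuous with `K ≥ 0` and `Rm(X, Y, Y, X) ≤ K(t) (g(X,X) g(Y,Y) - g(X,Y)²)` on `T_{γ(t)}M` FOR
`t ∈ [0, t₁]` ONLY (sectional curvature `≤ K(t)` along the segment; nothing is assumed about the
curvature elsewhere). If `-λ g(J(0), J(0)) ≤ g(D_tJ(0), J(0))` with `λ ≥ 0`, `J(t₁) = 0`, `0 < t₁`
and `λ t₁ + g(γ'(0), γ'(0)) · t₁ · ∫₀^{t₁} K < 1`, then `J(t) = 0` for all `t ∈ [0, t₁]` — the form of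
Warner's focal estimate used by Weinstein 1968 (step 4 of the proof): along the outward normal
geodesics of a hypersurface whose shape operator is `≥ -λ`, no focal point occurs within normal
distance `t₁` as long as `λ t₁ + |γ'|² t₁ ∫ K < 1`. Proof: steps (A)–(D) of the module docstring with
`a(0) ≥ -λ f(0)` in (A), so that `∫₀^{t₁} h ≤ c ∫₀^{t₁} K f + λ f(0) ≤ (c t₁ ∫₀^{t₁} K + λ t₁) ∫₀^{t₁} h`
by (B)–(C). [cite: Weinstein1968, main theorem (step 4 of the proof, via Warner 1965)]
[cite: LeeRiemannianManifolds2018, Thm. 11.12 (weak form, energy argument)] -/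
theorem eq_zero_of_jacobi_of_neg_le_of_integral_lt (hg : g.IsRiemannian)
    (hcompat : g.IsCompatible cov) {γ : ℝ → M} (hγ : IsGeodesicOn cov γ univ)
    {J : Π t : ℝ, TangentSpace I (γ t)}
    (hJ : ∀ t, MDifferentiableAt 𝓘(ℝ, ℝ) I.tangent
      (fun t ↦ (TotalSpace.mk' E (γ t) (J t) : TangentBundle I M)) t)
    (hDJ : ∀ t, MDifferentiableAt 𝓘(ℝ, ℝ) I.tangent
      (fun t ↦ (TotalSpace.mk' E (γ t) (covariantDerivAlong cov γ J t) : TangentBundle I M)) t)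
    (hjac : ∀ t, covariantDerivAlong cov γ (fun t ↦ covariantDerivAlong cov γ J t) t +
      cov.curvature (γ t) (J t) (velocity I γ t) (velocity I γ t) = 0)
    {t₁ : ℝ} (ht₁ : 0 < t₁)
    {K : ℝ → ℝ} (hKc : Continuous K) (hK0 : ∀ t ∈ Icc (0 : ℝ) t₁, 0 ≤ K t)
    (hsec : ∀ t ∈ Icc (0 : ℝ) t₁, ∀ (X Y : TangentSpace I (γ t)),
      g.curvatureForm cov (γ t) X Y Y X ≤
        K t * (g.val (γ t) X X * g.val (γ t) Y Y - g.val (γ t) X Y ^ 2))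
    {l : ℝ} (hl : 0 ≤ l)
    (h0 : -(l * g.val (γ 0) (J 0) (J 0)) ≤ g.val (γ 0) (covariantDerivAlong cov γ J 0) (J 0))
    (hJt₁ : J t₁ = 0)
    (hshort : l * t₁ +
      g.val (γ 0) (velocity I γ 0) (velocity I γ 0) * t₁ * (∫ s in (0 : ℝ)..t₁, K s) < 1) :
    ∀ t ∈ Icc (0 : ℝ) t₁, J t = 0 := by
  -- positive semidefiniteness
  have hnn : ∀ (x : M) (u : TangentSpace I x), 0 ≤ g.val x u u := fun x u ↦ by
    by_cases hu : u = 0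
    · subst hu
      simp
    · exact (hg x u hu).le
  set T : Π t : ℝ, TangentSpace I (γ t) := fun t ↦ velocity I γ t with hT_def
  set DJ : Π t : ℝ, TangentSpace I (γ t) := fun t ↦ covariantDerivAlong cov γ J t with hDJ_def
  /- the scalar functions and their derivatives -/
  set fF : ℝ → ℝ := fun t ↦ g.val (γ t) (J t) (J t) with hfF
  set aF : ℝ → ℝ := fun t ↦ g.val (γ t) (DJ t) (J t) with haF
  set hF : ℝ → ℝ := fun t ↦ g.val (γ t) (DJ t) (DJ t) with hhF
  have ha : ∀ t, HasDerivAt aF (g.val (γ t) (covariantDerivAlong cov γ DJ t) (J t) + hF t) t :=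
    fun t ↦ hasDerivAt_val_apply_along (g := g) hcompat (hDJ t) (hJ t)
  have hf : ∀ t, HasDerivAt fF (2 * aF t) t := fun t ↦ by
    have h := hasDerivAt_val_apply_along (g := g) hcompat (hJ t) (hJ t)
    have h' : g.val (γ t) (covariantDerivAlong cov γ J t) (J t) +
        g.val (γ t) (J t) (covariantDerivAlong cov γ J t) = 2 * aF t := by
      rw [g.symm (γ t) (J t) (covariantDerivAlong cov γ J t)]
      show aF t + aF t = 2 * aF t
      ring
    rw [h'] at h
    exact h
  have hh : ∀ t, HasDerivAt hF (g.val (γ t) (covariantDerivAlong cov γ DJ t) (DJ t) +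
      g.val (γ t) (DJ t) (covariantDerivAlong cov γ DJ t)) t :=
    fun t ↦ hasDerivAt_val_apply_along (g := g) hcompat (hDJ t) (hDJ t)
  have hfc : Continuous fF := continuous_iff_continuousAt.2 fun t ↦ (hf t).continuousAt
  have hhc : Continuous hF := continuous_iff_continuousAt.2 fun t ↦ (hh t).continuousAt
  have hf_nn : ∀ t, 0 ≤ fF t := fun t ↦ hnn (γ t) (J t)
  have hh_nn : ∀ t, 0 ≤ hF t := fun t ↦ hnn (γ t) (DJ t)
  /- constant speed -/
  set c : ℝ := g.val (γ 0) (T 0) (T 0) with hc_def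
  have hc_nn : 0 ≤ c := hnn (γ 0) (T 0)
  have hTT : ∀ t, g.val (γ t) (T t) (T t) = c := fun t ↦
    g.val_velocity_eq_of_isGeodesicOn_of_isCompatible hcompat isOpen_univ ordConnected_univ hγ
      (mem_univ t) (mem_univ 0)
  /- the curvature bound along the segment -/
  set κ : ℝ := ∫ s in (0 : ℝ)..t₁, K s with hκ_def
  have hκ : l * t₁ + c * t₁ * κ < 1 := hshort
  have hRm : ∀ t ∈ Icc (0 : ℝ) t₁,
      g.curvatureForm cov (γ t) (J t) (T t) (T t) (J t) ≤ K t * c * fF t := by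
    intro t ht
    have h1 := hsec t ht (J t) (T t)
    have h3 : K t * (g.val (γ t) (J t) (J t) * g.val (γ t) (T t) (T t) -
        g.val (γ t) (J t) (T t) ^ 2) ≤ K t * (g.val (γ t) (J t) (J t) * g.val (γ t) (T t) (T t)) :=
      mul_le_mul_of_nonneg_left (sub_le_self _ (sq_nonneg _)) (hK0 t ht)
    calc g.curvatureForm cov (γ t) (J t) (T t) (T t) (J t)
        ≤ K t * (g.val (γ t) (J t) (J t) * g.val (γ t) (T t) (T t) -
            g.val (γ t) (J t) (T t) ^ 2) := h1
      _ ≤ K t * (g.val (γ t) (J t) (J t) * g.val (γ t) (T t) (T t)) := h3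
      _ = K t * c * fF t := by
          rw [hTT t]
          show _ = K t * c * g.val (γ t) (J t) (J t)
          ring
  have ha' : ∀ t ∈ Icc (0 : ℝ) t₁,
      hF t - K t * c * fF t ≤ g.val (γ t) (covariantDerivAlong cov γ DJ t) (J t) + hF t := by
    intro t ht
    have h1 : covariantDerivAlong cov γ DJ t = -cov.curvature (γ t) (J t) (T t) (T t) :=
      eq_neg_of_add_eq_zero_left (hjac t)
    have h3 : g.val (γ t) (covariantDerivAlong cov γ DJ t) (J t) =
        -g.curvatureForm cov (γ t) (J t) (T t) (T t) (J t) := by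
      rw [h1, map_neg]
      rfl
    have h4 := hRm t ht
    linarith
  /- primitives -/
  set Hf : ℝ → ℝ := fun t ↦ ∫ s in (0 : ℝ)..t, hF s with hHf
  set Ff : ℝ → ℝ := fun t ↦ ∫ s in (0 : ℝ)..t, fF s with hFf
  have hH : ∀ t, HasDerivAt Hf (hF t) t := fun t ↦ (hhc.integral_hasStrictDerivAt 0 t).hasDerivAt
  have hFd : ∀ t, HasDerivAt Ff (fF t) t := fun t ↦ (hfc.integral_hasStrictDerivAt 0 t).hasDerivAt
  have hH0 : Hf 0 = 0 := by simp [hHf]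
  have hF0 : Ff 0 = 0 := by simp [hFf]
  have hHc : Continuous Hf := continuous_iff_continuousAt.2 fun t ↦ (hH t).continuousAt
  have hHmono : Monotone Hf :=
    monotone_of_deriv_nonneg (fun t ↦ (hH t).differentiableAt) fun t ↦ by
      rw [(hH t).deriv]; exact hh_nn t
  have hKfc : Continuous fun t ↦ K t * fF t := hKc.mul hfc
  set KF : ℝ → ℝ := fun t ↦ ∫ s in (0 : ℝ)..t, K s * fF s with hKF
  set Kp : ℝ → ℝ := fun t ↦ ∫ s in (0 : ℝ)..t, K s with hKp
  have hKFd : ∀ t, HasDerivAt KF (K t * fF t) t :=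
    fun t ↦ (hKfc.integral_hasStrictDerivAt 0 t).hasDerivAt
  have hKpd : ∀ t, HasDerivAt Kp (K t) t := fun t ↦ (hKc.integral_hasStrictDerivAt 0 t).hasDerivAt
  have hKF0 : KF 0 = 0 := by simp [hKF]
  have hKp0 : Kp 0 = 0 := by simp [hKp]
  have hKp1 : Kp t₁ = κ := rfl
  /- values at `t₁` -/
  have ha1 : aF t₁ = 0 := by show g.val (γ t₁) (DJ t₁) (J t₁) = 0; rw [hJt₁, map_zero]
  have hf1 : fF t₁ = 0 := by show g.val (γ t₁) (J t₁) (J t₁) = 0; rw [hJt₁]; simp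
  /- (A) `t ↦ a - ∫₀ᵗ h + c ∫₀ᵗ K f` is nondecreasing on `[0, t₁]` -/
  have hB : ∀ t, HasDerivAt (fun t ↦ aF t - Hf t + c * KF t)
      (g.val (γ t) (covariantDerivAlong cov γ DJ t) (J t) + hF t - hF t + c * (K t * fF t)) t :=
    fun t ↦ ((ha t).sub (hH t)).add ((hKFd t).const_mul c)
  have hBmono : MonotoneOn (fun t ↦ aF t - Hf t + c * KF t) (Icc 0 t₁) := by
    refine monotoneOn_of_deriv_nonneg (convex_Icc 0 t₁)
      (fun t _ ↦ (hB t).continuousAt.continuousWithinAt)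
      (fun t _ ↦ (hB t).differentiableAt.differentiableWithinAt) fun t ht ↦ ?_
    rw [interior_Icc] at ht
    rw [(hB t).deriv]
    have := ha' t ⟨ht.1.le, ht.2.le⟩
    have : K t * c * fF t = c * (K t * fF t) := by ring
    linarith
  have hA : Hf t₁ ≤ c * KF t₁ + l * fF 0 := by
    have h := hBmono (left_mem_Icc.2 ht₁.le) (right_mem_Icc.2 ht₁.le) ht₁.le
    simp only [ha1, hH0, hKF0] at h
    have h0' : -(l * fF 0) ≤ aF 0 := h0
    linarith
  /- (B) backward Poincaré inequality from the zero at `t₁` -/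
  have hquad : ∀ t : ℝ, 0 ≤ (t₁ - t) ^ 2 * hF t + 2 * (t₁ - t) * aF t + fF t := fun t ↦ by
    have hq := hnn (γ t) ((t₁ - t) • DJ t + J t)
    have h1 : g.val (γ t) ((t₁ - t) • DJ t + J t) ((t₁ - t) • DJ t + J t) =
        (t₁ - t) ^ 2 * hF t + 2 * (t₁ - t) * aF t + fF t := by
      have hs : g.val (γ t) (J t) (DJ t) = aF t := g.symm (γ t) (J t) (DJ t)
      simp only [map_add, map_smul, FunLike.coe_add, FunLike.coe_smul, Pi.add_apply,
        Pi.smul_apply, smul_eq_mul, hs]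
      show (t₁ - t) * ((t₁ - t) * hF t + aF t) + ((t₁ - t) * aF t + fF t) =
        (t₁ - t) ^ 2 * hF t + 2 * (t₁ - t) * aF t + fF t
      ring
    rw [h1] at hq
    exact hq
  have hR : ∀ t, t ≠ t₁ → HasDerivAt (fun t ↦ (Hf t₁ - Hf t) - fF t / (t₁ - t))
      ((0 - hF t) - (2 * aF t * (t₁ - t) - fF t * (0 - 1)) / (t₁ - t) ^ 2) t := fun t ht ↦
    ((hasDerivAt_const t (Hf t₁)).sub (hH t)).sub
      ((hf t).div ((hasDerivAt_const t t₁).sub (hasDerivAt_id t)) (sub_ne_zero.2 (Ne.symm ht)))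
  have hRanti : AntitoneOn (fun t ↦ (Hf t₁ - Hf t) - fF t / (t₁ - t)) (Iio t₁) := by
    refine antitoneOn_of_deriv_nonpos (convex_Iio t₁)
      (fun t ht ↦ (hR t (ne_of_lt ht)).continuousAt.continuousWithinAt)
      (fun t ht ↦ ?_) fun t ht ↦ ?_
    · rw [interior_Iio] at ht
      exact (hR t (ne_of_lt ht)).differentiableAt.differentiableWithinAt
    · rw [interior_Iio] at ht
      have hlt : t < t₁ := ht
      have hpos : 0 < t₁ - t := sub_pos.2 hlt
      rw [(hR t hlt.ne).deriv]
      have h1 : (0 - hF t) - (2 * aF t * (t₁ - t) - fF t * (0 - 1)) / (t₁ - t) ^ 2 =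
          -(((t₁ - t) ^ 2 * hF t + 2 * (t₁ - t) * aF t + fF t) / (t₁ - t) ^ 2) := by
        field_simp
        ring
      rw [h1, neg_nonpos]
      exact div_nonneg (hquad t) (sq_nonneg _)
  have hRlim : Tendsto (fun t ↦ (Hf t₁ - Hf t) - fF t / (t₁ - t)) (𝓝[<] t₁) (𝓝 0) := by
    have h1 : Tendsto (fun t ↦ Hf t₁ - Hf t) (𝓝[<] t₁) (𝓝 0) := by
      have h := (hHc.tendsto t₁).mono_left (nhdsWithin_le_nhds (s := Iio t₁))
      have h' := (tendsto_const_nhds (x := Hf t₁)).sub h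
      rw [sub_self] at h'
      exact h'
    have h2 : Tendsto (fun t ↦ fF t / (t₁ - t)) (𝓝[<] t₁) (𝓝 0) := by
      -- `fF t / (t₁ - t) = -(slope of fF at t₁) → -fF'(t₁) = -2 aF t₁ = 0`
      have h := (hf t₁).tendsto_slope_zero_left
      rw [ha1, mul_zero] at h
      have h' : Tendsto (fun t ↦ (t - t₁)⁻¹ • (fF (t₁ + (t - t₁)) - fF t₁)) (𝓝[<] t₁) (𝓝 0) := by
        have hmap : Tendsto (fun t : ℝ ↦ t - t₁) (𝓝[<] t₁) (𝓝[<] 0) := by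
          have hc' : Continuous fun t : ℝ ↦ t - t₁ := continuous_id.sub continuous_const
          refine tendsto_nhdsWithin_of_tendsto_nhds_of_eventually_within _ ?_ ?_
          · have := hc'.tendsto t₁
            rw [sub_self] at this
            exact this.mono_left nhdsWithin_le_nhds
          · filter_upwards [self_mem_nhdsWithin] with t (ht : t < t₁)
            exact sub_neg.2 ht
        exact h.comp hmap
      have h'' : Tendsto (fun t ↦ -((t - t₁)⁻¹ • (fF (t₁ + (t - t₁)) - fF t₁))) (𝓝[<] t₁) (𝓝 0) := by
        simpa using h'.neg
      refine h''.congr fun t ↦ ?_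
      rw [add_sub_cancel, hf1, sub_zero, smul_eq_mul, ← neg_mul, ← inv_neg, neg_sub,
        inv_mul_eq_div]
    have h := h1.sub h2
    rw [sub_zero] at h
    exact h
  have hfle : ∀ t, t < t₁ → fF t ≤ (t₁ - t) * (Hf t₁ - Hf t) := by
    intro t ht
    have hpos : 0 < t₁ - t := sub_pos.2 ht
    have hRt : 0 ≤ (Hf t₁ - Hf t) - fF t / (t₁ - t) := by
      refine le_of_tendsto hRlim ?_
      filter_upwards [Ico_mem_nhdsLT ht] with s hs
      exact hRanti (mem_Iio.2 ht) (mem_Iio.2 hs.2) hs.1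
    have h1 : fF t / (t₁ - t) ≤ Hf t₁ - Hf t := by linarith
    rwa [div_le_iff₀ hpos, mul_comm] at h1
  -- crude form on `[0, t₁]`: `f ≤ t₁ Hf t₁`
  have hfle' : ∀ t ∈ Icc (0 : ℝ) t₁, fF t ≤ t₁ * Hf t₁ := by
    intro t ht
    rcases ht.2.eq_or_lt with h | hlt
    · rw [h, hf1]
      exact mul_nonneg ht₁.le (hH0.symm.trans_le (hHmono ht₁.le))
    · have h1 := hfle t hlt
      have h2 : Hf t₁ - Hf t ≤ Hf t₁ := sub_le_self _ (hH0.symm.trans_le (hHmono ht.1))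
      have h3 : 0 ≤ Hf t₁ - Hf t := sub_nonneg.2 (hHmono ht.2)
      have h4 : (t₁ - t) * (Hf t₁ - Hf t) ≤ t₁ * Hf t₁ :=
        mul_le_mul (by linarith [ht.1]) h2 h3 ht₁.le
      exact h1.trans h4
  /- (C) `∫₀^{t₁} K f ≤ t₁ (Hf t₁) ∫₀^{t₁} K` -/
  have hG : ∀ t, HasDerivAt (fun t ↦ t₁ * Hf t₁ * Kp t - KF t)
      (t₁ * Hf t₁ * K t - K t * fF t) t :=
    fun t ↦ ((hKpd t).const_mul _).sub (hKFd t)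
  have hGmono : MonotoneOn (fun t ↦ t₁ * Hf t₁ * Kp t - KF t) (Icc 0 t₁) := by
    refine monotoneOn_of_deriv_nonneg (convex_Icc 0 t₁)
      (fun t _ ↦ (hG t).continuousAt.continuousWithinAt)
      (fun t _ ↦ (hG t).differentiableAt.differentiableWithinAt) fun t ht ↦ ?_
    rw [interior_Icc] at ht
    rw [(hG t).deriv]
    have h1 := hfle' t ⟨ht.1.le, ht.2.le⟩
    have h2 : t₁ * Hf t₁ * K t - K t * fF t = K t * (t₁ * Hf t₁ - fF t) := by ring
    rw [h2]
    exact mul_nonneg (hK0 t ⟨ht.1.le, ht.2.le⟩) (by linarith)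
  have hC : KF t₁ ≤ t₁ * Hf t₁ * κ := by
    have h := hGmono (left_mem_Icc.2 ht₁.le) (right_mem_Icc.2 ht₁.le) ht₁.le
    simp only [hKF0, hKp0, mul_zero, sub_zero] at h
    rw [hKp1] at h
    linarith
  /- (D) conclusion -/
  have hκ0 : 0 ≤ κ := by
    rw [hκ_def]
    exact intervalIntegral.integral_nonneg ht₁.le fun s hs ↦ hK0 s hs
  have hD : Hf t₁ ≤ 0 := by
    have hH1 : 0 ≤ Hf t₁ := hH0.symm.trans_le (hHmono ht₁.le)
    have hf0le : fF 0 ≤ t₁ * Hf t₁ := hfle' 0 (left_mem_Icc.2 ht₁.le)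
    have h1 : Hf t₁ ≤ c * (t₁ * Hf t₁ * κ) + l * (t₁ * Hf t₁) :=
      hA.trans (add_le_add (mul_le_mul_of_nonneg_left hC hc_nn)
        (mul_le_mul_of_nonneg_left hf0le hl))
    have h2 : (1 - (l * t₁ + c * t₁ * κ)) * Hf t₁ ≤ 0 := by nlinarith [h1]
    have h3 : 0 < 1 - (l * t₁ + c * t₁ * κ) := by linarith
    nlinarith [h2, h3, hH1]
  intro t ht
  have hft : fF t = 0 :=
    le_antisymm ((hfle' t ht).trans (mul_nonpos_of_nonneg_of_nonpos ht₁.le hD)) (hf_nn t)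
  exact CartanHadamard.eq_zero_of_val_self_eq_zero hg (γ t) hft

/-- **Core energy estimate: a Jacobi field with convex initial data and a zero at `t₁` vanishes
identically on `[0, t₁]` when `t₁` is short relative to the integrated curvature bound.** Let `cov`
be a covariant derivative compatible with the Riemannian `C^n` metric `g` (`n ≥ 1`), `γ` a
geodesic of `cov` on `ℝ`, `J` a field along `γ` such that the lifts of `J` and `D_t J` to `TM` are
differentiable and `D_t D_t J + R(J, γ') γ' = 0` (Jacobi equation), and let
`Rm(X, Y, Y, X) ≤ K(t) (g(X,X) g(Y,Y) - g(X,Y)²)` on `T_{γ(t)}M`, `K ≥ 0` continuous (sectional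
curvature `≤ K(t)` along `γ`). If `g(D_tJ(0), J(0)) ≥ 0`, `J(t₁) = 0` with `0 < t₁` and
`g(γ'(0), γ'(0)) · t₁ · ∫₀^{t₁} K < 1`, then `J(t) = 0` for all `t ∈ [0, t₁]`. Proof: steps (A)–(D)
of the module docstring (the energy argument; Lee 2018, Thm. 11.12 gives the sharp trigonometric
comparison for constant bounds instead); the case `λ = 0`, curvature bound on all of `γ`, of
`eq_zero_of_jacobi_of_neg_le_of_integral_lt`. [cite: LeeRiemannianManifolds2018, Thm. 11.12 (weak form, energy argument)] -/
theorem eq_zero_of_jacobi_of_integral_lt (hg : g.IsRiemannian)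
    (hcompat : g.IsCompatible cov) {γ : ℝ → M} (hγ : IsGeodesicOn cov γ univ)
    {J : Π t : ℝ, TangentSpace I (γ t)}
    (hJ : ∀ t, MDifferentiableAt 𝓘(ℝ, ℝ) I.tangent
      (fun t ↦ (TotalSpace.mk' E (γ t) (J t) : TangentBundle I M)) t)
    (hDJ : ∀ t, MDifferentiableAt 𝓘(ℝ, ℝ) I.tangent
      (fun t ↦ (TotalSpace.mk' E (γ t) (covariantDerivAlong cov γ J t) : TangentBundle I M)) t)
    (hjac : ∀ t, covariantDerivAlong cov γ (fun t ↦ covariantDerivAlong cov γ J t) t +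
      cov.curvature (γ t) (J t) (velocity I γ t) (velocity I γ t) = 0)
    {K : ℝ → ℝ} (hKc : Continuous K) (hK0 : ∀ t, 0 ≤ K t)
    (hsec : ∀ (t : ℝ) (X Y : TangentSpace I (γ t)), g.curvatureForm cov (γ t) X Y Y X ≤
      K t * (g.val (γ t) X X * g.val (γ t) Y Y - g.val (γ t) X Y ^ 2))
    (h0 : 0 ≤ g.val (γ 0) (covariantDerivAlong cov γ J 0) (J 0)) {t₁ : ℝ} (ht₁ : 0 < t₁)
    (hJt₁ : J t₁ = 0)
    (hshort : g.val (γ 0) (velocity I γ 0) (velocity I γ 0) * t₁ * (∫ s in (0 : ℝ)..t₁, K s) < 1) :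
    ∀ t ∈ Icc (0 : ℝ) t₁, J t = 0 :=
  eq_zero_of_jacobi_of_neg_le_of_integral_lt hg hcompat hγ hJ hDJ hjac ht₁ hKc (fun t _ ↦ hK0 t)
    (fun t _ X Y ↦ hsec t X Y) le_rfl (by rw [zero_mul, neg_zero]; exact h0) hJt₁
    (by rw [zero_mul, zero_add]; exact hshort)


/-- **Constant curvature bound.** In the setting of `eq_zero_of_jacobi_of_integral_lt`, with
`Rm(X, Y, Y, X) ≤ Λ (g(X,X) g(Y,Y) - g(X,Y)²)` everywhere (sectional curvature `≤ Λ`, any real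
`Λ`): if `g(D_tJ(0), J(0)) ≥ 0`, `J(t₁) = 0`, `0 < t₁` and `max Λ 0 · g(γ'(0),γ'(0)) · t₁² < 1` then
`J = 0` on `[0, t₁]` (`K = max Λ 0`, `∫₀^{t₁} K = t₁ max Λ 0`; Cauchy–Schwarz `sq_val_le_mul_val` to
pass from `Λ` to `max Λ 0`). [cite: LeeRiemannianManifolds2018, Thm. 11.12 (weak form)] -/
theorem eq_zero_of_jacobi_of_val_nonneg_of_eq_zero (hg : g.IsRiemannian)
    (hcompat : g.IsCompatible cov) {γ : ℝ → M} (hγ : IsGeodesicOn cov γ univ)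
    {J : Π t : ℝ, TangentSpace I (γ t)}
    (hJ : ∀ t, MDifferentiableAt 𝓘(ℝ, ℝ) I.tangent
      (fun t ↦ (TotalSpace.mk' E (γ t) (J t) : TangentBundle I M)) t)
    (hDJ : ∀ t, MDifferentiableAt 𝓘(ℝ, ℝ) I.tangent
      (fun t ↦ (TotalSpace.mk' E (γ t) (covariantDerivAlong cov γ J t) : TangentBundle I M)) t)
    (hjac : ∀ t, covariantDerivAlong cov γ (fun t ↦ covariantDerivAlong cov γ J t) t +
      cov.curvature (γ t) (J t) (velocity I γ t) (velocity I γ t) = 0)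
    {Λ : ℝ} (hsec : ∀ (x : M) (X Y : TangentSpace I x), g.curvatureForm cov x X Y Y X ≤
      Λ * (g.val x X X * g.val x Y Y - g.val x X Y ^ 2))
    (h0 : 0 ≤ g.val (γ 0) (covariantDerivAlong cov γ J 0) (J 0)) {t₁ : ℝ} (ht₁ : 0 < t₁)
    (hJt₁ : J t₁ = 0)
    (hshort : max Λ 0 * g.val (γ 0) (velocity I γ 0) (velocity I γ 0) * t₁ ^ 2 < 1) :
    ∀ t ∈ Icc (0 : ℝ) t₁, J t = 0 := by
  have hnn : ∀ (x : M) (u : TangentSpace I x), 0 ≤ g.val x u u := fun x u ↦ by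
    by_cases hu : u = 0
    · subst hu
      simp
    · exact (hg x u hu).le
  refine eq_zero_of_jacobi_of_integral_lt hg hcompat hγ hJ hDJ hjac (K := fun _ ↦ max Λ 0)
    continuous_const (fun _ ↦ le_max_right _ _) (fun t X Y ↦ ?_) h0 ht₁ hJt₁ ?_
  · have hgram : 0 ≤ g.val (γ t) X X * g.val (γ t) Y Y - g.val (γ t) X Y ^ 2 :=
      sub_nonneg.2 (sq_val_le_mul_val' hnn (γ t) X Y)
    exact (hsec (γ t) X Y).trans (mul_le_mul_of_nonneg_right (le_max_left _ _) hgram)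
  · rw [intervalIntegral.integral_const, sub_zero, smul_eq_mul]
    calc g.val (γ 0) (velocity I γ 0) (velocity I γ 0) * t₁ * (t₁ * max Λ 0)
        = max Λ 0 * g.val (γ 0) (velocity I γ 0) (velocity I γ 0) * t₁ ^ 2 := by ring
      _ < 1 := hshort

/-- **Conjugate version: no two conjugate zeros on a short geodesic segment** (Lee 2018,
Thm. 11.12 (b), weak form). In the setting of `eq_zero_of_jacobi_of_val_nonneg_of_eq_zero`, a
Jacobi field with `J(0) = 0` and `J(t₁) = 0`, `0 < t₁`, `max Λ 0 · |γ'|² · t₁² < 1`, vanishes on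
`[0, t₁]`. [cite: LeeRiemannianManifolds2018, Thm. 11.12 (b) (weak form)] -/
theorem eq_zero_of_jacobi_of_eq_zero_of_eq_zero (hg : g.IsRiemannian)
    (hcompat : g.IsCompatible cov) {γ : ℝ → M} (hγ : IsGeodesicOn cov γ univ)
    {J : Π t : ℝ, TangentSpace I (γ t)}
    (hJ : ∀ t, MDifferentiableAt 𝓘(ℝ, ℝ) I.tangent
      (fun t ↦ (TotalSpace.mk' E (γ t) (J t) : TangentBundle I M)) t)
    (hDJ : ∀ t, MDifferentiableAt 𝓘(ℝ, ℝ) I.tangent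
      (fun t ↦ (TotalSpace.mk' E (γ t) (covariantDerivAlong cov γ J t) : TangentBundle I M)) t)
    (hjac : ∀ t, covariantDerivAlong cov γ (fun t ↦ covariantDerivAlong cov γ J t) t +
      cov.curvature (γ t) (J t) (velocity I γ t) (velocity I γ t) = 0)
    {Λ : ℝ} (hsec : ∀ (x : M) (X Y : TangentSpace I x), g.curvatureForm cov x X Y Y X ≤
      Λ * (g.val x X X * g.val x Y Y - g.val x X Y ^ 2))
    (hJ0 : J 0 = 0) {t₁ : ℝ} (ht₁ : 0 < t₁) (hJt₁ : J t₁ = 0)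
    (hshort : max Λ 0 * g.val (γ 0) (velocity I γ 0) (velocity I γ 0) * t₁ ^ 2 < 1) :
    ∀ t ∈ Icc (0 : ℝ) t₁, J t = 0 :=
  eq_zero_of_jacobi_of_val_nonneg_of_eq_zero hg hcompat hγ hJ hDJ hjac hsec
    (by rw [hJ0, map_zero]) ht₁ hJt₁ hshort

/-- **Focal version: a Jacobi field with convex, nonzero initial data has no zero on a short
segment** (weak form of Warner's focal comparison theorem as used in Weinstein 1968, step 4: along
the outward normal geodesic of an infinitesimally convex hypersurface `S` — shape operator `≥ 0`
towards the normal, i.e. `g(D_tJ(0), J(0)) ≥ 0` for the `S`-Jacobi fields — there is no focal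
point within normal distance `t` as long as `max Λ 0 · |γ'|² · t² < 1`). In the setting of
`eq_zero_of_jacobi_of_val_nonneg_of_eq_zero`: if `g(D_tJ(0), J(0)) ≥ 0` and `J(0) ≠ 0` then
`J(t₁) ≠ 0` for every `t₁ > 0` with `max Λ 0 · g(γ'(0),γ'(0)) · t₁² < 1`.
[cite: Weinstein1968, main theorem (step 4 of the proof, via Warner 1965)]
[cite: LeeRiemannianManifolds2018, Thm. 11.12 (weak form)] -/
theorem ne_zero_of_jacobi_of_val_nonneg (hg : g.IsRiemannian)
    (hcompat : g.IsCompatible cov) {γ : ℝ → M} (hγ : IsGeodesicOn cov γ univ)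
    {J : Π t : ℝ, TangentSpace I (γ t)}
    (hJ : ∀ t, MDifferentiableAt 𝓘(ℝ, ℝ) I.tangent
      (fun t ↦ (TotalSpace.mk' E (γ t) (J t) : TangentBundle I M)) t)
    (hDJ : ∀ t, MDifferentiableAt 𝓘(ℝ, ℝ) I.tangent
      (fun t ↦ (TotalSpace.mk' E (γ t) (covariantDerivAlong cov γ J t) : TangentBundle I M)) t)
    (hjac : ∀ t, covariantDerivAlong cov γ (fun t ↦ covariantDerivAlong cov γ J t) t +
      cov.curvature (γ t) (J t) (velocity I γ t) (velocity I γ t) = 0)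
    {Λ : ℝ} (hsec : ∀ (x : M) (X Y : TangentSpace I x), g.curvatureForm cov x X Y Y X ≤
      Λ * (g.val x X X * g.val x Y Y - g.val x X Y ^ 2))
    (h0 : 0 ≤ g.val (γ 0) (covariantDerivAlong cov γ J 0) (J 0)) (hJ0 : J 0 ≠ 0)
    {t₁ : ℝ} (ht₁ : 0 < t₁)
    (hshort : max Λ 0 * g.val (γ 0) (velocity I γ 0) (velocity I γ 0) * t₁ ^ 2 < 1) :
    J t₁ ≠ 0 := fun hJt₁ ↦
  hJ0 (eq_zero_of_jacobi_of_val_nonneg_of_eq_zero hg hcompat hγ hJ hDJ hjac hsec h0 ht₁ hJt₁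
    hshort 0 (left_mem_Icc.2 ht₁.le))

/-- **Constant curvature bound along the segment, `λ`-convex initial data.** In the setting of
`eq_zero_of_jacobi_of_neg_le_of_integral_lt`, with `Rm(X, Y, Y, X) ≤ Λ (g(X,X) g(Y,Y) - g(X,Y)²)`
on `T_{γ(t)}M` for `t ∈ [0, t₁]` (sectional curvature `≤ Λ` along the segment, any real `Λ`): if
`-λ g(J(0),J(0)) ≤ g(D_tJ(0), J(0))`, `λ ≥ 0`, `J(t₁) = 0`, `0 < t₁` and
`λ t₁ + max Λ 0 · g(γ'(0),γ'(0)) · t₁² < 1`, then `J = 0` on `[0, t₁]` (`K = max Λ 0`).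
[cite: Weinstein1968, main theorem (step 4 of the proof, via Warner 1965)]
[cite: LeeRiemannianManifolds2018, Thm. 11.12 (weak form)] -/
theorem eq_zero_of_jacobi_of_neg_le_of_eq_zero (hg : g.IsRiemannian)
    (hcompat : g.IsCompatible cov) {γ : ℝ → M} (hγ : IsGeodesicOn cov γ univ)
    {J : Π t : ℝ, TangentSpace I (γ t)}
    (hJ : ∀ t, MDifferentiableAt 𝓘(ℝ, ℝ) I.tangent
      (fun t ↦ (TotalSpace.mk' E (γ t) (J t) : TangentBundle I M)) t)
    (hDJ : ∀ t, MDifferentiableAt 𝓘(ℝ, ℝ) I.tangent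
      (fun t ↦ (TotalSpace.mk' E (γ t) (covariantDerivAlong cov γ J t) : TangentBundle I M)) t)
    (hjac : ∀ t, covariantDerivAlong cov γ (fun t ↦ covariantDerivAlong cov γ J t) t +
      cov.curvature (γ t) (J t) (velocity I γ t) (velocity I γ t) = 0)
    {t₁ : ℝ} (ht₁ : 0 < t₁)
    {Λ : ℝ} (hsec : ∀ t ∈ Icc (0 : ℝ) t₁, ∀ (X Y : TangentSpace I (γ t)),
      g.curvatureForm cov (γ t) X Y Y X ≤
        Λ * (g.val (γ t) X X * g.val (γ t) Y Y - g.val (γ t) X Y ^ 2))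
    {l : ℝ} (hl : 0 ≤ l)
    (h0 : -(l * g.val (γ 0) (J 0) (J 0)) ≤ g.val (γ 0) (covariantDerivAlong cov γ J 0) (J 0))
    (hJt₁ : J t₁ = 0)
    (hshort : l * t₁ + max Λ 0 * g.val (γ 0) (velocity I γ 0) (velocity I γ 0) * t₁ ^ 2 < 1) :
    ∀ t ∈ Icc (0 : ℝ) t₁, J t = 0 := by
  have hnn : ∀ (x : M) (u : TangentSpace I x), 0 ≤ g.val x u u := fun x u ↦ by
    by_cases hu : u = 0
    · subst hu
      simp
    · exact (hg x u hu).le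
  refine eq_zero_of_jacobi_of_neg_le_of_integral_lt hg hcompat hγ hJ hDJ hjac ht₁
    (K := fun _ ↦ max Λ 0) continuous_const (fun _ _ ↦ le_max_right _ _) (fun t ht X Y ↦ ?_) hl
    h0 hJt₁ ?_
  · have hgram : 0 ≤ g.val (γ t) X X * g.val (γ t) Y Y - g.val (γ t) X Y ^ 2 :=
      sub_nonneg.2 (sq_val_le_mul_val' hnn (γ t) X Y)
    exact (hsec t ht X Y).trans (mul_le_mul_of_nonneg_right (le_max_left _ _) hgram)
  · rw [intervalIntegral.integral_const, sub_zero, smul_eq_mul]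
    calc l * t₁ + g.val (γ 0) (velocity I γ 0) (velocity I γ 0) * t₁ * (t₁ * max Λ 0)
        = l * t₁ + max Λ 0 * g.val (γ 0) (velocity I γ 0) (velocity I γ 0) * t₁ ^ 2 := by ring
      _ < 1 := hshort

/-- **Focal version with a shape-operator lower bound** (Warner's focal comparison in the weak form
consumed by Weinstein 1968, step 4): along the outward unit normal geodesic `γ` of a hypersurface
`S` whose shape operator towards the normal is `≥ -λ` (`λ ≥ 0`), an `S`-Jacobi field has initial data
with `g(D_tJ(0), J(0)) ≥ -λ g(J(0), J(0))`; if `J(0) ≠ 0` and the sectional curvature is `≤ Λ` along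
`γ|[0, t₁]`, then `J(t₁) ≠ 0` whenever `λ t₁ + max Λ 0 · g(γ'(0),γ'(0)) · t₁² < 1` — no focal point of
`S` within that normal distance. In Weinstein's proof `S = ∂D` is the boundary of a thin tube about a
curve of geodesic curvature `< Δ` ("second fundamental form `> -Δ` on unit vectors"), `Λ` bounds the
curvature of the unmodified metric outside `D`, and `t₁` is at most the (small) distance from `∂D`
to the cut point. [cite: Weinstein1968, main theorem (step 4 of the proof, via Warner 1965)] -/
theorem ne_zero_of_jacobi_of_neg_le (hg : g.IsRiemannian)
    (hcompat : g.IsCompatible cov) {γ : ℝ → M} (hγ : IsGeodesicOn cov γ univ)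
    {J : Π t : ℝ, TangentSpace I (γ t)}
    (hJ : ∀ t, MDifferentiableAt 𝓘(ℝ, ℝ) I.tangent
      (fun t ↦ (TotalSpace.mk' E (γ t) (J t) : TangentBundle I M)) t)
    (hDJ : ∀ t, MDifferentiableAt 𝓘(ℝ, ℝ) I.tangent
      (fun t ↦ (TotalSpace.mk' E (γ t) (covariantDerivAlong cov γ J t) : TangentBundle I M)) t)
    (hjac : ∀ t, covariantDerivAlong cov γ (fun t ↦ covariantDerivAlong cov γ J t) t +
      cov.curvature (γ t) (J t) (velocity I γ t) (velocity I γ t) = 0)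
    {t₁ : ℝ} (ht₁ : 0 < t₁)
    {Λ : ℝ} (hsec : ∀ t ∈ Icc (0 : ℝ) t₁, ∀ (X Y : TangentSpace I (γ t)),
      g.curvatureForm cov (γ t) X Y Y X ≤
        Λ * (g.val (γ t) X X * g.val (γ t) Y Y - g.val (γ t) X Y ^ 2))
    {l : ℝ} (hl : 0 ≤ l)
    (h0 : -(l * g.val (γ 0) (J 0) (J 0)) ≤ g.val (γ 0) (covariantDerivAlong cov γ J 0) (J 0))
    (hJ0 : J 0 ≠ 0)
    (hshort : l * t₁ + max Λ 0 * g.val (γ 0) (velocity I γ 0) (velocity I γ 0) * t₁ ^ 2 < 1) :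
    J t₁ ≠ 0 := fun hJt₁ ↦
  hJ0 (eq_zero_of_jacobi_of_neg_le_of_eq_zero hg hcompat hγ hJ hDJ hjac ht₁ hsec hl h0 hJt₁ hshort 0
    (left_mem_Icc.2 ht₁.le))

end Literature.Geometry.Riemannian

end
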